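import Mathlib
import Summits.ResolutionOfSingularities.ResolutionOfSingularities.Theorems.WeightedInvariantLocalWeightedDropMonicDescentBridgeSlices

/-!
# `WeightedInvariant.LocalWeightedDrop`, sub-stub `stub_monicDoublePointDescends`, piece T-6′ (game bridge), part 3:
# THE SECOND PRESENTATION OF A POINT SLICE (Möbius change of chart) AND THE CURVE SLICES

Crux item stmt-ResolutionOfSingularities-8899 `LocalWeightedDrop` (route `ResolutionOfSingularities/WeightedInvariant`), door
`HypersurfaceCentreConstruction` stmt-ResolutionOfSingularities-19897.  [OURS · L1 W4.3, chain w43, seat res-type-056 (T-6′ per SEAT TABLE v6);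
tools for the hypothesis hT6 of `MonicDescent.descends_of_pieces` (p488513).  Nothing here is a statement of any manuscript.]

* `represents_pointSlice_one` — exceptional point `(c₀ : c₁)` with `c₀c₁ ≠ 0`, slice `y′₁ = 0` (the Refuter may present the same point in
  either chart of the exceptional line): re-presented by the SAME label `blowOneLabel (shearLabel (C (c₁/c₀)) B)` as the `y′₀ = 0` presentation,
  via the Möbius change `τ = ((u₂+λ)u₁/c₁, c₁/(u₂+λ) − c₀)`, unit `u = c₁/(u₂+λ)`, `λ = c₁/c₀` (`det = −1/λ`);
* `represents_curveSlice_zero/one` — the slices of the blow-ups of `V(y,u₁)` / `V(y,u₂)` (spelling of `won_monic_of_curveBlowup`, divisibility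
  data `A′`): re-presented by `(A′₀, A′₁)` (scaling, resp. swap-scaling).
-/

set_option linter.dupNamespace false -- mandated namespace of this single-conjunct summit

noncomputable section

namespace Summit.ResolutionOfSingularities.ResolutionOfSingularities.Theorems

namespace MonicDescent

open MvPowerSeries Literature.RingTheory.TwoVariableSeries Literature.AlgebraicGeometry.Resolution

variable {k : Type} [Field k]

/-! ## The point blow-up, slice `y′₁ = 0` at `(c₀ : c₁)` with `c₀c₁ ≠ 0` (Möbius change of chart) -/

/-- POINT SLICE `y′₁ = 0` AT `(c₀ : c₁)`, `c₀c₁ ≠ 0`: the slice is re-presented by `blowOneLabel (shearLabel (C (c₁/c₀)) B)`, via the Möbius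
change `τ = ((u₂+λ)u₁/c₁, c₁/(u₂+λ) − c₀)` between the two affine charts of the exceptional line (`λ = c₁/c₀`), unit `u = c₁/(u₂+λ)`. -/
theorem represents_pointSlice_one {B₀ B₁ : MvPowerSeries (Fin 2) k} (hB : IsPosition B₀ B₁) (c : Fin 2 → k)
    (hc0 : c 0 ≠ 0) (hc : c 1 ≠ 0) (Bv : Fin 2 → MvPowerSeries (Fin 3) k)
    (hBv : ∀ j : Fin 2, subst (CobordantChart.chart (fun _ : Fin 2 => 1) c) ((![B₀, B₁] : Fin 2 → MvPowerSeries (Fin 2) k) j) =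
      X 0 ^ (2 - (j : ℕ) + 1) * Bv j) :
    Represents (pos (TupleGame.slice 1 (X 0 * Bv 0)) (TupleGame.slice 1 (X 0 * Bv 1)))
      (blowOne 2 (shear (C (c 1 / c 0)) B₀)) (blowOne 1 (shear (C (c 1 / c 0)) B₁)) := by
  obtain ⟨hT₀, hT₁⟩ := pointSlice_data c 1 Bv hBv
  rw [restrictedChart_point_one] at hT₀ hT₁
  obtain ⟨hB₀, hB₁⟩ := sum_ge_of_isPosition hB
  set lam : k := c 1 / c 0 with hlam
  have hlam0 : lam ≠ 0 := div_ne_zero hc hc0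
  -- the inverse of `u₂ + λ`
  have hLcc : constantCoeff (X 1 + C lam : MvPowerSeries (Fin 2) k) = lam := by
    rw [map_add, constantCoeff_X, constantCoeff_C, zero_add]
  obtain ⟨ι, hιdef⟩ : ∃ ι : MvPowerSeries (Fin 2) k, ι = (X 1 + C lam)⁻¹ := ⟨_, rfl⟩
  have hι : (X 1 + C lam) * ι = 1 := by
    rw [hιdef]; exact MvPowerSeries.mul_inv_cancel _ (by rw [hLcc]; exact hlam0)
  have hι0 : constantCoeff ι = lam⁻¹ := by rw [hιdef, MvPowerSeries.constantCoeff_inv, hLcc]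
  -- the linear coefficient of ι in `u₂`: `ι(0) + λ · coeff_{u₂} ι = 0`
  have hq : constantCoeff ι + lam * coeff (Finsupp.single 1 1) ι = 0 := by
    have h := congrArg (coeff (Finsupp.single (1 : Fin 2) 1)) hι
    rw [add_mul, map_add, mul_comm (X 1) ι, HyperbolicSplit.coeff_single_mul_X, if_pos rfl, coeff_C_mul, coeff_one,
      if_neg (Finsupp.single_ne_zero.mpr one_ne_zero)] at h
    exact h
  have hq0 : coeff (Finsupp.single 0 1) ι = 0 := by
    have h := congrArg (coeff (Finsupp.single (0 : Fin 2) 1)) hι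
    rw [add_mul, map_add, mul_comm (X 1) ι, HyperbolicSplit.coeff_single_mul_X, if_neg (by decide), coeff_C_mul, coeff_one,
      if_neg (Finsupp.single_ne_zero.mpr one_ne_zero), zero_add] at h
    exact (mul_eq_zero.mp h).resolve_left hlam0
  have h1 : C (c 1)⁻¹ * C (c 1) = (1 : MvPowerSeries (Fin 2) k) := by rw [← map_mul, inv_mul_cancel₀ hc, map_one]
  -- τ
  have hτ0 : ∀ i, constantCoeff ((![C (c 1)⁻¹ * (X 1 + C lam) * X 0, C (c 1) * ι - C (c 0)] :
      Fin 2 → MvPowerSeries (Fin 2) k) i) = 0 := by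
    intro i
    fin_cases i
    · show constantCoeff (C (c 1)⁻¹ * (X 1 + C lam) * X 0) = 0
      rw [map_mul, constantCoeff_X, mul_zero]
    · show constantCoeff (C (c 1) * ι - C (c 0)) = 0
      rw [map_sub, map_mul, constantCoeff_C, constantCoeff_C, hι0, hlam, inv_div, mul_div_cancel₀ _ hc, sub_self]
  have hs : HasSubst (![C (c 1)⁻¹ * (X 1 + C lam) * X 0, C (c 1) * ι - C (c 0)] : Fin 2 → MvPowerSeries (Fin 2) k) :=
    hasSubst_of_constantCoeff_zero hτ0
  -- R ∘ τ = (u₁, u₁(u₂ + λ))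
  have hR : HasSubst (![X 0 * (C (c 0) + X 1), X 0 * C (c 1)] : Fin 2 → MvPowerSeries (Fin 2) k) :=
    hasSubst_of_constantCoeff_zero (by intro i; fin_cases i <;> simp [constantCoeff_X])
  have hcomp : ∀ B : MvPowerSeries (Fin 2) k,
      subst ![C (c 1)⁻¹ * (X 1 + C lam) * X 0, C (c 1) * ι - C (c 0)] (subst ![X 0 * (C (c 0) + X 1), X 0 * C (c 1)] B) =
        subst ![(X 0 : MvPowerSeries (Fin 2) k), X 0 * (X 1 + C lam)] B := by
    intro B
    refine (subst_comp_subst_apply hR hs B).trans ?_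
    congr 1
    funext i
    fin_cases i
    · show subst ![C (c 1)⁻¹ * (X 1 + C lam) * X 0, C (c 1) * ι - C (c 0)] (X 0 * (C (c 0) + X 1)) = X 0
      rw [subst_mul hs, subst_add hs, subst_X hs, subst_X hs, subst_C]
      show C (c 1)⁻¹ * (X 1 + C lam) * X 0 * (C (c 0) + (C (c 1) * ι - C (c 0))) = X 0
      linear_combination (X 0 * (C (c 1)⁻¹ * C (c 1))) * hι + X 0 * h1
    · show subst ![C (c 1)⁻¹ * (X 1 + C lam) * X 0, C (c 1) * ι - C (c 0)] (X 0 * C (c 1)) = X 0 * (X 1 + C lam)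
      rw [subst_mul hs, subst_X hs, subst_C]
      show C (c 1)⁻¹ * (X 1 + C lam) * X 0 * C (c 1) = X 0 * (X 1 + C lam)
      linear_combination (X 0 * (X 1 + C lam)) * h1
  refine represents_of_sliceData ![C (c 1)⁻¹ * (X 1 + C lam) * X 0, C (c 1) * ι - C (c 0)] (C (c 1) * ι) hτ0 ?_ ?_ ?_
    hT₀ hT₁ ?_ ?_
  · -- det = λ · coeff_{u₂} ι · (c₁⁻¹ c₁) = −ι(0) ≠ 0
    have h00 : FormalCoordChange.linMat ![C (c 1)⁻¹ * (X 1 + C lam) * X 0, C (c 1) * ι - C (c 0)] 0 0 = (c 1)⁻¹ * lam := by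
      simp only [FormalCoordChange.linMat, Matrix.of_apply, Matrix.cons_val_zero]
      rw [HyperbolicSplit.coeff_single_mul_X, if_pos rfl, map_mul, constantCoeff_C, hLcc]
    have h01 : FormalCoordChange.linMat ![C (c 1)⁻¹ * (X 1 + C lam) * X 0, C (c 1) * ι - C (c 0)] 0 1 = 0 := by
      simp only [FormalCoordChange.linMat, Matrix.of_apply, Matrix.cons_val_zero]
      rw [HyperbolicSplit.coeff_single_mul_X, if_neg (by decide)]
    have h11 : FormalCoordChange.linMat ![C (c 1)⁻¹ * (X 1 + C lam) * X 0, C (c 1) * ι - C (c 0)] 1 1 =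
        c 1 * coeff (Finsupp.single 1 1) ι := by
      show coeff (Finsupp.single 1 1) (C (c 1) * ι - C (c 0)) = _
      rw [map_sub, coeff_C_mul, coeff_C, if_neg (Finsupp.single_ne_zero.mpr one_ne_zero), sub_zero]
    rw [Matrix.det_fin_two, h00, h01, h11, zero_mul, sub_zero, isUnit_iff_ne_zero]
    have hval : (c 1)⁻¹ * lam * (c 1 * coeff (Finsupp.single 1 1) ι) = -lam⁻¹ := by
      have : lam * coeff (Finsupp.single 1 1) ι = -lam⁻¹ := by rw [← hι0]; linear_combination hq
      calc (c 1)⁻¹ * lam * (c 1 * coeff (Finsupp.single 1 1) ι) = ((c 1)⁻¹ * c 1) * (lam * coeff (Finsupp.single 1 1) ι) := by ring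
        _ = -lam⁻¹ := by rw [inv_mul_cancel₀ hc, one_mul, this]
    rw [hval, neg_ne_zero]
    exact inv_ne_zero hlam0
  · show C (c 1)⁻¹ * (X 1 + C lam) * X 0 ≠ 0
    refine mul_ne_zero (mul_ne_zero ?_ ?_) (X_ne_zero' _)
    · rw [Ne, map_eq_zero_iff _ C_injective]; exact inv_ne_zero hc
    · intro h
      have := congrArg constantCoeff h
      rw [hLcc, map_zero] at this
      exact hlam0 this
  · rw [map_mul, constantCoeff_C, hι0, hlam, inv_div, mul_div_cancel₀ _ hc]
    exact hc0
  · rw [hcomp, ← X_pow_mul_blowOne_shear_C 2 lam B₀ hB₀]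
    show X 0 ^ 2 * _ = (C (c 1)⁻¹ * (X 1 + C lam) * X 0) ^ 2 * ((C (c 1) * ι) ^ 2 * _)
    linear_combination (-(X 0 ^ 2 * blowOne 2 (shear (C lam) B₀) *
        ((C (c 1)⁻¹ * C (c 1)) * ((X 1 + C lam) * ι) + 1) * (C (c 1)⁻¹ * C (c 1)))) * hι +
      (-(X 0 ^ 2 * blowOne 2 (shear (C lam) B₀) * ((C (c 1)⁻¹ * C (c 1)) * ((X 1 + C lam) * ι) + 1))) * h1
  · rw [hcomp, ← X_pow_mul_blowOne_shear_C 1 lam B₁ hB₁, pow_one]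
    show X 0 * _ = C (c 1)⁻¹ * (X 1 + C lam) * X 0 * (C (c 1) * ι * _)
    linear_combination (-(X 0 * blowOne 1 (shear (C lam) B₁) * (C (c 1)⁻¹ * C (c 1)))) * hι +
      (-(X 0 * blowOne 1 (shear (C lam) B₁))) * h1

/-! ## The curve blow-ups -/

/-- CURVE SLICE of the blow-up of `V(y, u₁)` at `c₁ ≠ 0`: `y² + c₁² A′₀(c₁s, u₂) + c₁ A′₁(c₁s, u₂) y` is re-presented by `(A′₀, A′₁)`
(scaling `θ = (u₁/c₁, u₂, c₁y)`). -/
theorem represents_curveSlice_zero (A₀' A₁' : MvPowerSeries (Fin 2) k) (ci : k) (hci : ci ≠ 0) :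
    Represents (pos
        (C (ci ^ 2) * TupleGame.slice 0 (subst (CobordantChart.chart (fun l : Fin 2 => if l = 0 then 1 else 0)
          (fun l : Fin 2 => if l = 0 then ci else 0)) A₀'))
        (C ci * TupleGame.slice 0 (subst (CobordantChart.chart (fun l : Fin 2 => if l = 0 then 1 else 0)
          (fun l : Fin 2 => if l = 0 then ci else 0)) A₁')))
      A₀' A₁' := by
  rw [curveSlice_data, curveSlice_data, restrictedChart_curve_zero]
  have hτ0 : ∀ i, constantCoeff ((![C ci⁻¹ * X 0, X 1] : Fin 2 → MvPowerSeries (Fin 2) k) i) = 0 := by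
    intro i; fin_cases i <;> simp [constantCoeff_X]
  have hs : HasSubst (![C ci⁻¹ * X 0, X 1] : Fin 2 → MvPowerSeries (Fin 2) k) := hasSubst_of_constantCoeff_zero hτ0
  have hR : HasSubst (![X 0 * C ci, X 1] : Fin 2 → MvPowerSeries (Fin 2) k) :=
    hasSubst_of_constantCoeff_zero (by intro i; fin_cases i <;> simp [constantCoeff_X])
  have h1 : C ci⁻¹ * C ci = (1 : MvPowerSeries (Fin 2) k) := by rw [← map_mul, inv_mul_cancel₀ hci, map_one]
  have hcomp : ∀ B : MvPowerSeries (Fin 2) k, subst ![C ci⁻¹ * X 0, X 1] (subst ![X 0 * C ci, X 1] B) = B := by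
    intro B
    refine (subst_comp_subst_apply hR hs B).trans ?_
    have hX : (fun s : Fin 2 => subst ![C ci⁻¹ * X 0, X 1] ((![X 0 * C ci, X 1] : Fin 2 → MvPowerSeries (Fin 2) k) s)) = X := by
      funext i
      fin_cases i
      · show subst ![C ci⁻¹ * X 0, X 1] (X 0 * C ci) = X 0
        rw [subst_mul hs, subst_X hs, subst_C]
        show C ci⁻¹ * X 0 * C ci = X 0
        linear_combination (X 0) * h1
      · show subst ![C ci⁻¹ * X 0, X 1] (X 1) = X 1
        rw [subst_X hs]
        rfl
    rw [hX]
    exact congrFun subst_self B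
  refine represents_pos_of_subst ![C ci⁻¹ * X 0, X 1] (C ci) hτ0 ?_ ?_ ?_ ?_
  · have h00 : FormalCoordChange.linMat ![C ci⁻¹ * X 0, X 1] 0 0 = ci⁻¹ := by simp [FormalCoordChange.linMat]
    have h01 : FormalCoordChange.linMat ![C ci⁻¹ * X 0, X 1] 0 1 = 0 := by simp [FormalCoordChange.linMat, coeff_index_single_X]
    have h11 : FormalCoordChange.linMat ![C ci⁻¹ * X 0, X 1] 1 1 = 1 := by simp [FormalCoordChange.linMat]
    rw [Matrix.det_fin_two, h00, h01, h11, zero_mul, sub_zero, mul_one, isUnit_iff_ne_zero]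
    exact inv_ne_zero hci
  · rw [constantCoeff_C]; exact hci
  · rw [subst_mul hs, subst_C, hcomp, map_pow]
  · rw [subst_mul hs, subst_C, hcomp]

/-- CURVE SLICE of the blow-up of `V(y, u₂)` at `c₂ ≠ 0`: re-presented by `(A′₀, A′₁)` (swap-scaling `θ = (u₂/c₂, u₁, c₂y)`). -/
theorem represents_curveSlice_one (A₀' A₁' : MvPowerSeries (Fin 2) k) (ci : k) (hci : ci ≠ 0) :
    Represents (pos
        (C (ci ^ 2) * TupleGame.slice 1 (subst (CobordantChart.chart (fun l : Fin 2 => if l = 1 then 1 else 0)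
          (fun l : Fin 2 => if l = 1 then ci else 0)) A₀'))
        (C ci * TupleGame.slice 1 (subst (CobordantChart.chart (fun l : Fin 2 => if l = 1 then 1 else 0)
          (fun l : Fin 2 => if l = 1 then ci else 0)) A₁')))
      A₀' A₁' := by
  rw [curveSlice_data, curveSlice_data, restrictedChart_curve_one]
  have hτ0 : ∀ i, constantCoeff ((![C ci⁻¹ * X 1, X 0] : Fin 2 → MvPowerSeries (Fin 2) k) i) = 0 := by
    intro i; fin_cases i <;> simp [constantCoeff_X]
  have hs : HasSubst (![C ci⁻¹ * X 1, X 0] : Fin 2 → MvPowerSeries (Fin 2) k) := hasSubst_of_constantCoeff_zero hτ0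
  have hR : HasSubst (![X 1, X 0 * C ci] : Fin 2 → MvPowerSeries (Fin 2) k) :=
    hasSubst_of_constantCoeff_zero (by intro i; fin_cases i <;> simp [constantCoeff_X])
  have h1 : C ci⁻¹ * C ci = (1 : MvPowerSeries (Fin 2) k) := by rw [← map_mul, inv_mul_cancel₀ hci, map_one]
  have hcomp : ∀ B : MvPowerSeries (Fin 2) k, subst ![C ci⁻¹ * X 1, X 0] (subst ![X 1, X 0 * C ci] B) = B := by
    intro B
    refine (subst_comp_subst_apply hR hs B).trans ?_
    have hX : (fun s : Fin 2 => subst ![C ci⁻¹ * X 1, X 0] ((![X 1, X 0 * C ci] : Fin 2 → MvPowerSeries (Fin 2) k) s)) = X := by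
      funext i
      fin_cases i
      · show subst ![C ci⁻¹ * X 1, X 0] (X 1) = X 0
        rw [subst_X hs]
        rfl
      · show subst ![C ci⁻¹ * X 1, X 0] (X 0 * C ci) = X 1
        rw [subst_mul hs, subst_X hs, subst_C]
        show C ci⁻¹ * X 1 * C ci = X 1
        linear_combination (X 1) * h1
    rw [hX]
    exact congrFun subst_self B
  refine represents_pos_of_subst ![C ci⁻¹ * X 1, X 0] (C ci) hτ0 ?_ ?_ ?_ ?_
  · have h00 : FormalCoordChange.linMat ![C ci⁻¹ * X 1, X 0] 0 0 = 0 := by simp [FormalCoordChange.linMat, coeff_index_single_X]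
    have h01 : FormalCoordChange.linMat ![C ci⁻¹ * X 1, X 0] 0 1 = ci⁻¹ := by simp [FormalCoordChange.linMat]
    have h10 : FormalCoordChange.linMat ![C ci⁻¹ * X 1, X 0] 1 0 = 1 := by simp [FormalCoordChange.linMat]
    rw [Matrix.det_fin_two, h00, h01, h10, zero_mul, mul_one, zero_sub, isUnit_iff_ne_zero, neg_ne_zero]
    exact inv_ne_zero hci
  · rw [constantCoeff_C]; exact hci
  · rw [subst_mul hs, subst_C, hcomp, map_pow]
  · rw [subst_mul hs, subst_C, hcomp]

end MonicDescent

end Summit.ResolutionOfSingularities.ResolutionOfSingularities.Theorems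

end
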